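import Summits.QuantumAdvantage.QuantumAdvantage.Theses.SupportDial
import Summits.QuantumAdvantage.QuantumAdvantage.Theorems.SupportDialResidueCertificateH

/-!
# SupportDial — P1 `NoPerfectMinority3` (stmt-QuantumAdvantage-31926) and the sign-twist items hold

The `H := univ` block of `Theses.SupportDial.closes` (writer g5 rev 4, critic PB24 (2)): on the bare `n`-cycle a
strategy whose every output reads at most `c·n/(2c+2)` inputs has coordinate `𝔽₂`-degree `≤ c·n/(2c+2) ≤ (n−3)/2`
once `n ≥ 2c+5`, so the half-degree law `HalfDegreeLaw2` (crux stmt-QuantumAdvantage-32140, PROVED in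
`Theorems.SupportDialResidueCertificateH` by lens-1 g7's sign-twist certificate) already defeats it.
Hence `NoPerfectMinority3` (crux 31926) holds outright, and the SupportDial line to `NoPerfectConst3` (27380)
rests on `MinorityLift3` (31929) alone.  Also recorded by name: `SignTwistLift2` (32827); `SignTwistLaw2` (32826) is `SupportDialResidueCertificate.signTwistLaw2` itself (definitionally the route decl; no restatement here).

Cell decomp-qadv (D-0178/D-0179), census seat decomp-qadv-census-1 g6 (prover lane); mathematics: lens-1 g6/g7
(SupportDial / ResidueDial nodes), writer g5 sketch `NoPerfectMinority3OfHalfDegree.lean`.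
-/

set_option linter.dupNamespace false -- D-0017: single-problem summit ⇒ `QuantumAdvantage.QuantumAdvantage` by design

namespace Summit.QuantumAdvantage.QuantumAdvantage.Theorems.SupportDialMinority

open Summit.QuantumAdvantage.QuantumAdvantage.Theses.SupportDial

/-- The engine glue at `H := univ`: the `p = 2` half-degree law on the bare cycle implies P1 (no perfect
constant-degree MINORITY-reader strategy), because an output reading `≤ c·n/(2c+2)` inputs is an `𝔽₂`-polynomial of
degree `≤ c·n/(2c+2)` and `2·(c·n/(2c+2)) + 3 ≤ n` for `n ≥ 2c+5`. -/
theorem noPerfectMinority3_of_halfDegreeLaw2 (hD : HalfDegreeLaw2) : NoPerfectMinority3 := by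
  classical
  intro c d
  refine ⟨2 * c + 5, fun n hn P _hP hS => ?_⟩
  choose S hS using hS
  have hk : 5 ≤ n := by omega
  have ht : 2 * (c * n / (2 * c + 2)) + 3 ≤ n := by
    have h1 := Nat.div_mul_le_self (c * n) (2 * c + 2)
    by_contra h
    have h' := not_le.mp h
    nlinarith [h1, hn, h']
  obtain ⟨β, hβ, hrel⟩ := hD n (c * n / (2 * c + 2)) hk ht (fun β j => decide (P j β = 1))
    (fun j => Literature.Computability.MetaComplexity.Smolensky.lowDeg_mono (hS j).1
      (Summit.QuantumAdvantage.AdviceFreeQNC0.AffBells22.indicator_mem_lowDeg (S j) _ (hS j).2))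
  exact ⟨β, hβ, hrel⟩

/-- **P1 holds** (crux stmt-QuantumAdvantage-31926 `SupportDial.NoPerfectMinority3`): for every `c` and every constant
`d`, for all large `n`, no ring strategy with `𝔽₃`-degree-`≤ d` outputs each reading at most `c·n/(2c+2)` inputs is
perfect on the odd class — from the PROVED half-degree law. -/
theorem noPerfectMinority3_holds : NoPerfectMinority3 :=
  noPerfectMinority3_of_halfDegreeLaw2
    Summit.QuantumAdvantage.QuantumAdvantage.Theorems.SupportDialResidueCertificate.halfDegreeLaw2_holds

/-- The by-name glue (support stmt-QuantumAdvantage-32827 `SupportDial.SignTwistLift2`): the sign-twist law implies the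
half-degree law (moment law + Y-step, `SupportDialResidueCertificate.halfDegreeLaw2_of_signTwist`). -/
theorem signTwistLift2_holds : SignTwistLift2 :=
  fun hS => Summit.QuantumAdvantage.QuantumAdvantage.Theorems.SupportDialResidueCertificate.halfDegreeLaw2_of_signTwist hS

/-- Record: with P1 proved, the SupportDial `closes` chain needs only the residual `MinorityLift3` (31929) and the
shared ProductDial/ExactnessDial lifts to reach the leaf. -/
theorem closes_of_minorityLift (h2 : MinorityLift3) (hC : ConstLift3) (hM : MassStep3u) (hO : OddToAll3)
    (hDP : DPLift3) : Summit.QuantumAdvantage.AdviceFreeQNC0.AdviceFreeQNC0Three :=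
  closes Summit.QuantumAdvantage.QuantumAdvantage.Theorems.SupportDialResidueCertificate.signTwistLaw2
    signTwistLift2_holds h2 hC hM hO hDP

end Summit.QuantumAdvantage.QuantumAdvantage.Theorems.SupportDialMinority
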